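import Mathlib.Analysis.SpecialFunctions.Complex.Arg
import Mathlib.Analysis.Real.Pi.Bounds
import Mathlib.Analysis.SpecialFunctions.Trigonometric.Arctan
import Literature.NumberTheory.LFunctions.XiMultiplePositivityProofs
import Literature.NumberTheory.LFunctions.ZetaRealAxis
import Literature.NumberTheory.DiophantineGeometry.NamedHypothesesRHProofs
import Literature.Analysis.TotalPositivity.GenusZeroSector
import Literature.Analysis.TotalPositivity.MultiplyPositiveProofs
import Literature.NumberTheory.LFunctions.ZetaArgumentCertificate
import HarnessLib

/-!
# Katkova's Theorem 1 (`ξ₁ ∈ PF₄₄`) from RH up to height `16`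

Trunk T-NT-LFUNC (Literature/NumberTheory/LFunctions). Node G2 (the `ξ`-specific part) of the
decomposition of the named fact `Literature.NumberTheory.LFunctions.katkova_pf44` (`XiMultiplePositivity.lean`;
[Katkova2006, Thm. 1, arXiv p. 4]: every Toeplitz minor of order `≤ 44` of `(γ(n)/n!)ₙ` is `≥ 0`).

Katkova's printed proof: "(r1) `ξ(s) ≠ 0` for `1/2 < Re s ≤ 1, 0 ≤ Im s ≤ 14` [Titchmarsh,
Ch. XV] … all zeros `z_k` of `ξ₁` lie in the angle `{z : |π - arg z| ≤ π/44}`. We also have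
`ξ₁(0) > 0`. `ξ₁` is an entire function of order `1/2` … by the Hadamard theorem
`ξ₁ = C ∏ (1 - z/z_k)` … by Theorem B [Schoenberg 1955] `P_N ∈ PF₄₄` … `ξ₁` is the uniform limit of
the `P_N`, hence `ξ₁ ∈ PF₄₄`." The general limiting argument is
`Literature.Analysis.TotalPositivity.isMultiplyPositiveSeq_taylor_of_zeros_in_sector` (`GenusZeroSector.lean`,
taking Hadamard's theorem `Literature.Analysis.Complex.hadamard_genus_zero` [Conway 1978, XI.3.4] and Theorem B
`Literature.Analysis.TotalPositivity.schoenberg_sector_pf` as hypotheses; both are proved in the tree,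
`hadamard_genus_zero_holds`, `schoenberg_sector_pf_holds`). Katkova's `ξ₁(z) = ξ(√z + 1/2)` is
the tree's `Literature.NumberTheory.LFunctions.xiSq` (`ZetaLogDerivSeries.lean`, `xiSq_sq : xiSq (w²) = ξ(1/2 + w)`), whose
inputs are landed in `XiMultiplePositivityProofs.lean`: it is entire of order `< 1`
(`isEntireOfOrderLtOne_xiSq`), has real Taylor coefficients (`im_iteratedDeriv_xiSq`) with
`ξ₁⁽ⁿ⁾(0)/n! = 8⁻¹ · γ(n)/n!` (`re_iteratedDeriv_xiSq_div`), and `ξ₁(0) = ξ(1/2) > 0`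
(`xiSq_zero_re_pos`). Here we supply the location of the zeros and assemble.

**On the height in (r1).** A zero of `ξ₁` is `w = (ρ - 1/2)²` for a non-trivial zero `ρ` of
`ζ`; if `Re ρ = 1/2` then `w < 0`, and if `|Im ρ| > T`, `|Re ρ - 1/2| < 1/2`, then
`|π - |arg w|| ≤ 2 arctan(1/(2T)) < 1/T` (`abs_arg_sq_ge`). Theorem B with `m = 44` needs the
zero-free sector `|arg z| < 44π/45`, i.e. `|π - arg z_k| ≤ π/45`, which requires the off-line
zeros to have `|Im ρ| ≥ ½ cot(π/90) = 14.318…`; the printed height `14` yields only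
`2 arctan(1/28) = 0.0713982… > π/45 = 0.0698…` (it is `< π/44 = 0.0713998…`), i.e. `PF₄₃` by
Theorem B as stated. The statement of Theorem 1 is nevertheless true as printed, since the
classical verifications go far beyond height `14.32` (Gram 1903, Backlund 1914; the zeros
`14.13…, 21.02…` are on the line). We therefore take the numerical input in the form
`Literature.RiemannHypothesisUpTo T` with `m + 1 ≤ πT` (`T = 16` for `m = 44`); it is PROVED for
`T = 16` in `ZetaArgumentCertificate.lean` (kernel-checked Backlund certificate),
which yields the unconditional `katkova_pf44_holds` (and `PF₄₉`,
`isMultiplyPositiveSeq_xi_fortyNine`, since `50 ≤ 16π`); we also keep the interface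
`katkova_pf44_of_riemannHypothesisUpTo` and the instance from the tree's named hypothesis
`riemannHypothesisUpTo_platt_trudgian` [PlattTrudgian2021, Thm. 1].

## Main results

* `abs_arg_sq_ge` (the sector estimate), `abs_arg_ge_of_xiSq_eq_zero` (zeros of `ξ₁` lie in
  `|arg w| ≥ π - 1/T` under `RiemannHypothesisUpTo T`).
* `katkova_pf44_iff : katkova_pf44 ↔ IsMultiplyPositiveSeq 44 (γ(n)/n!)`.
* `isMultiplyPositiveSeq_xi_of : hadamard_genus_zero → schoenberg_sector_pf →
  RiemannHypothesisUpTo T → m + 1 ≤ πT → IsMultiplyPositiveSeq m (γ(n)/n!)`; `katkova_pf44_of`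
  (`m = 44`, `T = 16`); `isMultiplyPositiveSeq_xi_of_riemannHypothesisUpTo`,
  `katkova_pf44_of_riemannHypothesisUpTo : RiemannHypothesisUpTo 16 → katkova_pf44` (Hadamard
  and Theorem B fed in); `katkova_pf44_of_plattTrudgian`,
  `isMultiplyPositiveSeq_xi_of_plattTrudgian` (`PF_m` for all `m + 1 ≤ 9·10¹²`).
* `katkova_pf44_holds : katkova_pf44` — **Katkova's Theorem 1, proved** (DISCHARGE of the named
  fact), from `Literature.NumberTheory.LFunctions.riemannHypothesisUpTo_sixteen`; `isMultiplyPositiveSeq_xi_fortyNine` (`PF₄₉`).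

## References

* O. M. Katkova, *Multiple positivity and the Riemann zeta-function*, CMFT 7 (2007) 13–31;
  arXiv:math/0505174, Thm. 1 and its proof, and the remark following it (p. 4). [Katkova2006]
* I. J. Schoenberg, Rend. Circ. Mat. Palermo (2) 4 (1955) 123–131 (Theorem B). [Schoenberg1955]
* D. Platt, T. Trudgian, *The Riemann hypothesis is true up to `3·10¹²`*, Bull. LMS 53 (2021),
  Thm. 1. [PlattTrudgian2021]
* E. C. Titchmarsh, *The Theory of the Riemann Zeta-Function*, 2nd ed. 1986, §2.12, Ch. XV.
-/

noncomputable section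

open Complex Literature.Analysis.TotalPositivity
open scoped Nat ComplexConjugate

namespace Literature.NumberTheory.LFunctions

/-! ### The zeros of `ξ₁` and the sector -/

/-- A zero `w` of `ξ₁ = xiSq` is `(ρ - 1/2)²` for a zero `ρ = 1/2 + z` of `ζ` in the open critical
strip, which is non-real (`xiSq_sq`, `riemannXi_eq_zero_iff_holds`,
`im_ne_zero_of_riemannZeta_eq_zero`). [cite: Titchmarsh1986, §2.12] -/
theorem exists_zeta_zero_of_xiSq_eq_zero {w : ℂ} (hw : xiSq w = 0) :
    ∃ z : ℂ, z ^ 2 = w ∧ riemannZeta (1 / 2 + z) = 0 ∧ -(1 / 2) < z.re ∧ z.re < 1 / 2 ∧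
      z.im ≠ 0 := by
  obtain ⟨z, hz⟩ := IsAlgClosed.exists_pow_nat_eq w (n := 2) (by norm_num)
  have hξ : riemannXi (1 / 2 + z) = 0 := by rw [← xiSq_sq, hz, hw]
  obtain ⟨hζ, h0, h1⟩ := (riemannXi_eq_zero_iff_holds (1 / 2 + z)).1 hξ
  have him := im_ne_zero_of_riemannZeta_eq_zero hζ h0 h1
  simp only [Complex.add_re, Complex.add_im, Complex.div_ofNat_re, Complex.one_re,
    Complex.div_ofNat_im, Complex.one_im, zero_div, zero_add] at h0 h1 him
  exact ⟨z, hz, hζ, by linarith, by linarith, him⟩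

/-- `cos (2 arctan t) = (1 - t²)/(1 + t²)`. [folklore] -/
theorem cos_two_mul_arctan (t : ℝ) :
    Real.cos (2 * Real.arctan t) = (1 - t ^ 2) / (1 + t ^ 2) := by
  rw [Real.cos_two_mul, Real.cos_sq_arctan]
  have h : (0 : ℝ) < 1 + t ^ 2 := by positivity
  field_simp
  ring

/-- `arctan t ≤ t` for `t ≥ 0`. [folklore] -/
theorem arctan_le_self {t : ℝ} (ht : 0 ≤ t) : Real.arctan t ≤ t := by
  have h := Real.le_tan (Real.arctan_nonneg.2 ht) (Real.arctan_lt_pi_div_two t)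
  rwa [Real.tan_arctan] at h

/-- **The sector estimate.** If `z = x + iy` with `|x| ≤ 1/2` and `|y| > T > 0` then
`|arg (z²)| ≥ π - 1/T`: `cos (arg z²) = (x² - y²)/(x² + y²) = cos (π - 2 arctan (|x|/|y|))`, both
angles lie in `[0, π]`, so `|arg z²| = π - 2 arctan (|x|/|y|) ≥ π - 2|x|/|y| ≥ π - 1/T`.
(With Katkova's height `14`: `2 arctan (1/28) = 0.0713982… < π/44 = 0.0713998…`, her
"`|π - arg z_k| ≤ π/44`".) [cite: Katkova2006, Thm. 1 (proof, (r1))] -/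
theorem abs_arg_sq_ge {z : ℂ} {T : ℝ} (hT : 0 < T) (hre : |z.re| ≤ 1 / 2) (him : T < |z.im|) :
    Real.pi - 1 / T ≤ |Complex.arg (z ^ 2)| := by
  have hy : 0 < |z.im| := hT.trans him
  have hy0 : z.im ≠ 0 := abs_pos.1 hy
  have hz0 : z ≠ 0 := fun h => hy0 (by rw [h]; simp)
  have hw0 : z ^ 2 ≠ 0 := pow_ne_zero _ hz0
  set t : ℝ := |z.re| / |z.im| with ht
  have ht0 : 0 ≤ t := div_nonneg (abs_nonneg _) (abs_nonneg _)
  have htT : 2 * t ≤ 1 / T := by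
    have h1 : t ≤ (1 / 2) / T := by
      rw [ht]
      calc |z.re| / |z.im| ≤ (1 / 2) / |z.im| := by gcongr
        _ ≤ (1 / 2) / T := by gcongr
    calc 2 * t ≤ 2 * ((1 / 2) / T) := by linarith
      _ = 1 / T := by ring
  -- `cos (arg z²) = cos (π - 2 arctan t)`
  have hcos : Real.cos (Complex.arg (z ^ 2)) = Real.cos (Real.pi - 2 * Real.arctan t) := by
    rw [Real.cos_pi_sub, cos_two_mul_arctan, Complex.cos_arg hw0]
    have hwre : (z ^ 2).re = z.re ^ 2 - z.im ^ 2 := by rw [pow_two, Complex.mul_re]; ring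
    have hwnorm : ‖z ^ 2‖ = z.re ^ 2 + z.im ^ 2 := by
      rw [norm_pow, Complex.sq_norm, Complex.normSq_apply]; ring
    rw [hwre, hwnorm, ht, div_pow, sq_abs, sq_abs]
    have hy2 : 0 < z.im ^ 2 := by positivity
    field_simp
    ring
  -- both angles lie in `[0, π]`, where `cos` is injective
  have hφ0 : 0 < Real.pi - 2 * Real.arctan t := by
    linarith [Real.arctan_lt_pi_div_two t]
  have hφπ : Real.pi - 2 * Real.arctan t ≤ Real.pi := by
    linarith [Real.arctan_nonneg.2 ht0]
  have heq : |Complex.arg (z ^ 2)| = Real.pi - 2 * Real.arctan t := by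
    refine Real.injOn_cos ⟨abs_nonneg _, Complex.abs_arg_le_pi _⟩ ⟨hφ0.le, hφπ⟩ ?_
    rw [Real.cos_abs, hcos]
  rw [heq]
  linarith [arctan_le_self ht0]

/-- **Zeros of `ξ₁` lie in `|arg w| ≥ π - 1/T`, given RH up to height `T > 0`.** A zero is
`w = z²`, `ρ = 1/2 + z` a non-trivial zero of `ζ`: if `|Im ρ| ≤ T` then `Re ρ = 1/2`
(`RiemannHypothesisUpTo T`, `RiemannHypothesisUpTo.re_eq_of_im_neg` for `Im ρ < 0`), so
`w = -(Im ρ)² < 0` and `arg w = π`; otherwise `|Im ρ| > T`, `|Re ρ - 1/2| < 1/2` and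
`abs_arg_sq_ge` applies. [cite: Katkova2006, Thm. 1 (proof, (r1))] -/
theorem abs_arg_ge_of_xiSq_eq_zero {T : ℝ} (hRH : DiophantineGeometry.RiemannHypothesisUpTo T) (hT : 0 < T) {w : ℂ}
    (hw : xiSq w = 0) : Real.pi - 1 / T ≤ |Complex.arg w| := by
  obtain ⟨z, rfl, hζ, hre, hre', him⟩ := exists_zeta_zero_of_xiSq_eq_zero hw
  by_cases hT' : |z.im| ≤ T
  · -- on the critical line: `z.re = 0`
    have hzre : z.re = 0 := by
      rcases lt_or_gt_of_ne him with hneg | hpos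
      · have h := hRH.re_eq_of_im_neg hζ (by simpa using hneg) (by
          simp only [Complex.add_im, Complex.div_ofNat_im, Complex.one_im, zero_div, zero_add]
          rw [abs_of_neg hneg] at hT'; exact hT')
        simp at h
        linarith
      · have h := hRH _ hζ (by simpa using hpos) (by
          simp only [Complex.add_im, Complex.div_ofNat_im, Complex.one_im, zero_div, zero_add]
          rw [abs_of_pos hpos] at hT'; exact hT')
        simp at h
        linarith
    have harg : Complex.arg (z ^ 2) = Real.pi := by
      rw [Complex.arg_eq_pi_iff, pow_two, Complex.mul_re, Complex.mul_im, hzre]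
      constructor
      · nlinarith [sq_pos_of_ne_zero him]
      · ring
    rw [harg, abs_of_pos Real.pi_pos]
    linarith [one_div_pos.2 hT]
  · exact abs_arg_sq_ge hT (abs_le.2 ⟨by linarith, by linarith⟩) (not_le.1 hT')

/-! ### Assembly -/

/-- `katkova_pf44` is `PF₄₄` for `(γ(n)/n!)ₙ` in the sense of `IsMultiplyPositiveSeq` (the route's
inline minors are the `toeplitzMinor`s, `xiToeplitzMinor_eq`). [cite: Katkova2006, Thm. 1] -/
theorem katkova_pf44_iff :
    katkova_pf44 ↔ IsMultiplyPositiveSeq 44 (fun n => xiTaylorCoeff n / (n ! : ℝ)) := by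
  refine ⟨fun h k hk r c hr hc => ?_, fun h k hk r c hr hc => ?_⟩
  · rw [← xiToeplitzMinor_eq]
    exact h k hk r c hr hc
  · have h' := h k hk r c hr hc
    rwa [← xiToeplitzMinor_eq] at h'

/-- **Katkova's argument with a general height** (her remark after the proof of Thm. 1: "the
height of rectangle in (r1) can be increased essentially. So, the constant `44` in Theorem 1 can
be also increased"): GIVEN Hadamard's factorisation in genus `0` (`hH`) and Schoenberg's Theorem B
(`hB`), if every zero of `ζ` with `0 < Im ρ ≤ T` lies on the critical line and `m + 1 ≤ πT`, then
`(γ(n)/n!)ₙ` is `m`-times positive: the zeros of `ξ₁ = xiSq` lie in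
`|arg w| ≥ π - 1/T ≥ πm/(m+1)` (`abs_arg_ge_of_xiSq_eq_zero`),
`isMultiplyPositiveSeq_taylor_of_zeros_in_sector` applies to the real entire function `xiSq` of
order `< 1` with `xiSq 0 = ξ(1/2) > 0`, and its Taylor sequence is `8⁻¹ · (γ(n)/n!)`
(`re_iteratedDeriv_xiSq_div`, rescaled by `IsMultiplyPositiveSeq.smul`).
[cite: Katkova2006, remark after Thm. 1] -/
theorem isMultiplyPositiveSeq_xi_of (hH : Literature.Analysis.Complex.hadamard_genus_zero)
    (hB : schoenberg_sector_pf) {T : ℝ} {m : ℕ} (hRH : DiophantineGeometry.RiemannHypothesisUpTo T)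
    (hmT : (m : ℝ) + 1 ≤ Real.pi * T) :
    IsMultiplyPositiveSeq m (fun n => xiTaylorCoeff n / (n ! : ℝ)) := by
  have hT : 0 < T := by
    have h1 : (0 : ℝ) < (m : ℝ) + 1 := by positivity
    nlinarith [Real.pi_pos]
  have hsector : Real.pi * m / (m + 1) ≤ Real.pi - 1 / T := by
    have hm0 : (0 : ℝ) < (m : ℝ) + 1 := by positivity
    rw [show Real.pi * m / (m + 1) = Real.pi - Real.pi / (m + 1) by field_simp; ring]
    have : 1 / T ≤ Real.pi / (m + 1) := by
      rw [div_le_div_iff₀ hT hm0]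
      linarith
    linarith
  have hpf : IsMultiplyPositiveSeq m (fun n => (iteratedDeriv n xiSq 0).re / (n ! : ℝ)) :=
    isMultiplyPositiveSeq_taylor_of_zeros_in_sector hH hB isEntireOfOrderLtOne_xiSq
      im_iteratedDeriv_xiSq xiSq_zero_re_pos
      fun z hz => hsector.trans (abs_arg_ge_of_xiSq_eq_zero hRH hT hz)
  have hcoef : (fun n => (iteratedDeriv n xiSq 0).re / (n ! : ℝ)) =
      fun n => 8⁻¹ * (xiTaylorCoeff n / (n ! : ℝ)) := funext re_iteratedDeriv_xiSq_div
  rw [hcoef] at hpf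
  have h8 := hpf.smul (C := 8) (by norm_num)
  have hf : (fun n => 8 * (8⁻¹ * (xiTaylorCoeff n / (n ! : ℝ)))) =
      fun n => xiTaylorCoeff n / (n ! : ℝ) := by
    funext n; ring
  rwa [hf] at h8

/-- **Katkova's Theorem 1 from the three printed inputs**: Hadamard's factorisation theorem in
genus `0` (`Literature.Analysis.Complex.hadamard_genus_zero`, [Conway 1978, XI.3.4]), Schoenberg's sector theorem
(`Literature.Analysis.TotalPositivity.schoenberg_sector_pf`, [Katkova2006, §1 Thm. B]) and RH up to height `16`
(`Literature.RiemannHypothesisUpTo 16`; `45 ≤ 16π`). [cite: Katkova2006, Thm. 1] -/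
theorem katkova_pf44_of (hH : Literature.Analysis.Complex.hadamard_genus_zero) (hB : schoenberg_sector_pf)
    (hRH : DiophantineGeometry.RiemannHypothesisUpTo 16) : katkova_pf44 :=
  katkova_pf44_iff.2 (isMultiplyPositiveSeq_xi_of hH hB hRH (by
    norm_num; linarith [Real.pi_gt_three]))

/-- **`ξ₁ ∈ PF_m` from RH up to height `T ≥ (m+1)/π`, otherwise unconditionally**: the
factorisation theorem of Hadamard (`Literature.Analysis.Complex.hadamard_genus_zero_holds`) and Schoenberg's
Theorem B (`Literature.Analysis.TotalPositivity.schoenberg_sector_pf_holds`) are proved in the tree.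
[cite: Katkova2006, remark after Thm. 1] -/
theorem isMultiplyPositiveSeq_xi_of_riemannHypothesisUpTo {T : ℝ} {m : ℕ}
    (hRH : DiophantineGeometry.RiemannHypothesisUpTo T) (hmT : (m : ℝ) + 1 ≤ Real.pi * T) :
    IsMultiplyPositiveSeq m (fun n => xiTaylorCoeff n / (n ! : ℝ)) :=
  isMultiplyPositiveSeq_xi_of Literature.Analysis.Complex.hadamard_genus_zero_holds schoenberg_sector_pf_holds
    hRH hmT

/-- **Katkova's Theorem 1, conditional only on RH up to height `16`** (the numerical input (r1);
the sharp height needed for `m = 44` via Theorem B is `½ cot(π/90) = 14.318…`, see the module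
docstring). `RiemannHypothesisUpTo 16` is proved in `ZetaArgumentCertificate.lean`.
[cite: Katkova2006, Thm. 1] -/
theorem katkova_pf44_of_riemannHypothesisUpTo (hRH : DiophantineGeometry.RiemannHypothesisUpTo 16) : katkova_pf44 :=
  katkova_pf44_of Literature.Analysis.Complex.hadamard_genus_zero_holds schoenberg_sector_pf_holds hRH

/-- **Katkova's Theorem 1 from Platt–Trudgian**: the numerical input `RiemannHypothesisUpTo 16` is
an instance of the tree's named hypothesis `riemannHypothesisUpTo_platt_trudgian` (RH up to
`3 000 175 332 800`, [PlattTrudgian2021, Thm. 1]). [cite: Katkova2006, Thm. 1] -/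
theorem katkova_pf44_of_plattTrudgian (hPT : DiophantineGeometry.riemannHypothesisUpTo_platt_trudgian) :
    katkova_pf44 :=
  katkova_pf44_of_riemannHypothesisUpTo (hPT.mono_of_le (by norm_num))

/-- **`ξ₁ ∈ PF_m` for all `m + 1 ≤ 9·10¹²` from Platt–Trudgian** (`π · 3000175332800 > 9·10¹²`):
Katkova's "the constant `44` in Theorem 1 can be also increased essentially", made quantitative
with [PlattTrudgian2021, Thm. 1]. In particular a negative Toeplitz minor of `(γ(n)/n!)ₙ` (route
TotalPositivity, `TpNegativeCertificate`) must have order `> 9·10¹²` unless the Platt–Trudgian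
verification is wrong. [cite: Katkova2006, remark after Thm. 1] -/
theorem isMultiplyPositiveSeq_xi_of_plattTrudgian (hPT : DiophantineGeometry.riemannHypothesisUpTo_platt_trudgian)
    {m : ℕ} (hm : (m : ℝ) + 1 ≤ 9 * 10 ^ 12) :
    IsMultiplyPositiveSeq m (fun n => xiTaylorCoeff n / (n ! : ℝ)) :=
  isMultiplyPositiveSeq_xi_of_riemannHypothesisUpTo hPT (hm.trans (by
    norm_num; nlinarith [Real.pi_gt_three]))

/-! ### Discharge -/

/-- **Katkova's Theorem 1 (`ξ₁ ∈ PF₄₄`), proved**: DISCHARGE of the named fact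
`Literature.NumberTheory.LFunctions.katkova_pf44` — every Toeplitz minor of order `≤ 44` of `(γ(n)/n!)ₙ` is non-negative.
All inputs of the printed proof are theorems of the tree: Hadamard's genus-zero factorisation
(`hadamard_genus_zero_holds`), Schoenberg's Theorem B (`schoenberg_sector_pf_holds`), the order
and realness of `ξ₁` and `ξ₁(0) > 0` (`XiMultiplePositivityProofs.lean`), and the numerical input
(r1) in the form RH up to height `16` (`Literature.NumberTheory.LFunctions.riemannHypothesisUpTo_sixteen`, a kernel-checked
Backlund certificate, `ZetaArgumentCertificate.lean`). [cite: Katkova2006, Thm. 1] -/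
theorem katkova_pf44_holds : katkova_pf44 :=
  katkova_pf44_of_riemannHypothesisUpTo riemannHypothesisUpTo_sixteen

/-- **`ξ₁ ∈ PF₄₉` unconditionally** (`50 ≤ 16π`): Katkova's remark "the constant `44` in
Theorem 1 can be also increased" with the height `16`. [cite: Katkova2006, remark after Thm. 1] -/
theorem isMultiplyPositiveSeq_xi_fortyNine :
    IsMultiplyPositiveSeq 49 (fun n => xiTaylorCoeff n / (n ! : ℝ)) :=
  isMultiplyPositiveSeq_xi_of_riemannHypothesisUpTo riemannHypothesisUpTo_sixteen (by
    norm_num; nlinarith [Real.pi_gt_d2])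

end Literature.NumberTheory.LFunctions

end
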